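import Summits.QuantumFields.YangMills.Theses.SteinGapBootstrap
import Summits.QuantumFields.YangMills.Theorems.SteinGapBootstrapGapGivesClusteringG

/-!
# Route `SteinGapBootstrap`, repaired crux K2R `GapGivesClusteringGR` (item stmt-QuantumFields-23209)

`GapGivesClusteringGR` is the rev-2 crux `GapGivesClusteringG` with `0 ≤ β →` inserted after `∀ β : ℝ,`:
for every compact simple `G`, faithful unitary `r`, every `β ≥ 0`, every torus-limit state `μ` (d = 4) and every
`m` with `HasRPTimeGap μ m`, positive-time observables `A, B` bounded by `a, b` cluster at rate `m`:
`|∫ A(θU) B(τ_t U) dμ − ∫ A∘θ dμ · ∫ B∘τ_t dμ| ≤ 2 e^{−mt} a b`.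

This is, verbatim up to unfolding, the statement of the landed theorem
`Summit.QuantumFields.YangMills.Theorems.SteinGapBootstrap.gapGivesClusteringG_of_nonneg`
(module `Theorems/SteinGapBootstrapGapGivesClusteringG.lean`: time-zero site reflection positivity of every
torus-limit state at `β ≥ 0`, symmetry of the RP pair form, Cauchy–Schwarz, and the one-sided gap at even times).

Honest label: this closes the support item K2R of a route whose target is the RECORD rung `WeakCouplingRates.XiPow`
(an upper bound on the lattice correlation length exponent); no Yang–Mills mass gap and no summit is proved here.
-/

namespace Summit.QuantumFields.YangMills.Theorems.SteinGapBootstrap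

/-- **K2R** (item stmt-QuantumFields-23209): the repaired clustering crux `GapGivesClusteringGR` of route
`SteinGapBootstrap` holds — it is the landed theorem `gapGivesClusteringG_of_nonneg` (crux K2 restricted to `0 ≤ β`). -/
theorem GapGivesClusteringGR_proof :
    Summit.QuantumFields.YangMills.Theses.SteinGapBootstrap.GapGivesClusteringGR := by
  unfold Summit.QuantumFields.YangMills.Theses.SteinGapBootstrap.GapGivesClusteringGR
  exact gapGivesClusteringG_of_nonneg

end Summit.QuantumFields.YangMills.Theorems.SteinGapBootstrap
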